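import Mathlib
import HarnessLib.Audit
import Summits.PneNP.PneNP.Theorems.PstarGateCasePRegimes

/-!
# One GATED chord, CASE P: an EXC-unit chord and an (EQ) chord cannot COEXIST (E2 node N2X, the three-chord branch is empty; prover-1 g21)

FRONTIER range-avoidance ladder, rung F-N3 (`stmt-PneNP-19007`), cell `pnp-ideate` (`PstarGateNodesX.GateCasePUnitsX`); restricted-model proof
complexity — nothing here bears on `P` versus `NP`.

`PstarGateCasePRegimes.caseP_regimes` leaves, besides the all-(NOR) regime (node N1, closed), at most TWO other chords: at most one EXC-unit `e'`
(`UnitCert`: `D e' = {j₁, j₂}`, literals `σ ∈ j₁`, `τ ∈ j₂`, polar formula) and at most one (EQ) chord `e''` (`EqCert`: `Q_{D e''} = q + κ''`,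
`q = q_{(1,0)}`).  Pure algebra kills the pair: by `PstarNorUnitMixed.D_subset_of_EQ_of_excUnit`, `D e'' = D e' + k` for the `{σ,τ}`-gadget `k`,
so `q = Q_{D e'} + x_σ x_τ + κ''`; the CASE P containment `Z(q) ⊆ {Q_{D e'} = c}` (`PstarGateBridge.caseP_forced`) evaluated at two explicit
points of `Z(q)` (`e_σ`-type and `e_σ + e_τ`-type indicator vectors, `ind_mul`) gives `c = κ''` and `c = κ'' + 1`:

* `unit_eq_false` — **an EXC-unit chord and a distinct (EQ) chord, with the unit forced ON on `Z(q)`, are contradictory.**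
-/

set_option linter.dupNamespace false -- `Summit.PneNP.PneNP.…`: summit = sub-problem name (D-0017 single-conjunct layout)

open Finset Literature.Computability.Complexity
open Summit.PneNP.PneNP.Theorems.PstarSALevel (SimpleOverlap)
open Summit.PneNP.PneNP.Theorems.PstarGapLinearised (andPair)
open Summit.PneNP.PneNP.Theorems.PstarChordEndgameTools (mem_andPair_iff)
open Summit.PneNP.PneNP.Theorems.PstarProductRank (qform polar)
open Summit.PneNP.PneNP.Theorems.PstarPathRank (and_ne)
open Summit.PneNP.PneNP.Theorems.PstarReadSumset (V2)
open Summit.PneNP.PneNP.Theorems.PstarChordBridgeTools (xpdeg)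
open Summit.PneNP.PneNP.Theorems.PstarChordBridge (BridgeData)
open Summit.PneNP.PneNP.Theorems.PstarChordBridgeBasis (qDir polarDir)
open Summit.PneNP.PneNP.Theorems.PstarChordBridgeCorner (qDir_add)
open Summit.PneNP.PneNP.Theorems.PstarChordBridgeFundamental (eq_of_fundamental_eq)
open Summit.PneNP.PneNP.Theorems.PstarNorUnitGraph (eq_of_two_shared)
open Summit.PneNP.PneNP.Theorems.PstarNorUnitMixed (ne_of_unit D_subset_of_EQ_of_excUnit)
open Summit.PneNP.PneNP.Theorems.PstarGateCasePRegimes (EqCert UnitCert)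

namespace Summit.PneNP.PneNP.Theorems.PstarGateCasePUnitsMixed

variable {n m : ℕ}

/-- Product of two indicator values of a finite set of coordinates. -/
theorem ind_mul (S : Finset (Fin n)) (a b : Fin n) [Decidable (a ∈ S ∧ b ∈ S)] :
    (fun w : Fin n => if w ∈ S then (1 : ZMod 2) else 0) a * (fun w : Fin n => if w ∈ S then (1 : ZMod 2) else 0) b =
      if (a ∈ S ∧ b ∈ S) then 1 else 0 := by
  by_cases ha : a ∈ S <;> by_cases hb : b ∈ S <;> simp [ha, hb]

/-- The AND-sum of a two-element family. -/
theorem qform_pair_family (I : LocalMap 4 n m) {j₁ j₂ : Fin m} (hne : j₁ ≠ j₂) (x : Fin n → ZMod 2) :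
    qform ({j₁, j₂} : Finset (Fin m)) (fun j => I.vars j 2) (fun j => I.vars j 3) x =
      x (I.vars j₁ 2) * x (I.vars j₁ 3) + x (I.vars j₂ 2) * x (I.vars j₂ 3) := by
  unfold qform
  rw [sum_pair hne]

/-- **An EXC-unit chord and a distinct (EQ) chord cannot coexist under the CASE P forcing of the unit.** -/
theorem unit_eq_false (I : LocalMap 4 n m) (hI : I.IsPure xorAndPred) (hS : SimpleOverlap I) {B : BridgeData n m} (hW : B.WF I)
    {e' e'' : Fin m} (he' : e' ∈ B.N) (he'' : e'' ∈ B.N) (hne : e' ≠ e'') (hU : UnitCert I B (B.D e')) (hE : EqCert I B (B.D e''))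
    {c : ZMod 2} (hP1 : ∀ x, qDir I B (1, 0) x = 0 → qform (B.D e') (fun j => I.vars j 2) (fun j => I.vars j 3) x = c) : False := by
  classical
  obtain ⟨j₁, j₂, σ, τ, hj, hD, hdisj, hσ, hτ, hform⟩ := hU
  obtain ⟨κ, hEQ⟩ := hE
  have hστ : σ ≠ τ := ne_of_unit I hdisj hσ hτ
  obtain ⟨hsub, hmem, -⟩ := D_subset_of_EQ_of_excUnit I hI hS hD hdisj hσ hτ hform (q := qDir I B (1, 0)) (qDir_add I B (1, 0)) hEQ
  -- `D e'' ≠ D e'`, so a gadget `k ∈ D e'' ∖ D e'` exists, and `D e'' = D e' + k`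
  have he'D : e' ∉ B.D e' := fun h => (mem_sdiff.1 (hW.hD e' he' h)).2 he'
  have hDne : B.D e'' ≠ B.D e' := by
    intro hDD
    have he''D : e'' ∉ B.D e' := fun h => (mem_sdiff.1 (hW.hD e' he' h)).2 he''
    have hev'' : ∀ w, Even (xpdeg I (insert e'' (B.D e')) w) := fun w => by
      have h := hW.hDeven e'' he'' w; rwa [hDD] at h
    exact hne (eq_of_fundamental_eq I hI hS he'D he''D (hW.hDeven e' he') hev'')
  obtain ⟨k, hk'', hk'⟩ : ∃ k ∈ B.D e'', k ∉ B.D e' := by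
    by_contra hno
    push Not at hno
    exact hDne (Subset.antisymm hno hsub)
  obtain ⟨hσk, hτk⟩ := (hmem k hk'').resolve_left hk'
  have hDins : B.D e'' = insert k (B.D e') := by
    refine Subset.antisymm (fun k' hk' => ?_) (insert_subset hk'' hsub)
    rw [mem_insert]
    by_cases h : k' ∈ B.D e'
    · exact Or.inr h
    · left
      obtain ⟨hσk', hτk'⟩ := (hmem k' hk').resolve_left h
      by_contra hkk
      exact eq_of_two_shared hS hkk hστ hσk' hσk hτk' hτk
  -- names for the unit's AND variables
  set a₁ := I.vars j₁ 2 with ha₁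
  set b₁ := I.vars j₁ 3 with hb₁
  set a₂ := I.vars j₂ 2 with ha₂
  set b₂ := I.vars j₂ 3 with hb₂
  have hab₁ : a₁ ≠ b₁ := and_ne I hI j₁
  have hab₂ : a₂ ≠ b₂ := and_ne I hI j₂
  have hσ' : σ = a₁ ∨ σ = b₁ := (mem_andPair_iff I j₁ σ).1 hσ
  have hτ' : τ = a₂ ∨ τ = b₂ := (mem_andPair_iff I j₂ τ).1 hτ
  have hdj : ∀ v, v ∈ andPair I j₁ → v ∉ andPair I j₂ := fun v hv hv' => Finset.disjoint_left.1 hdisj hv hv'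
  have ha₁₂ : a₁ ∉ andPair I j₂ := hdj a₁ ((mem_andPair_iff I j₁ a₁).2 (Or.inl rfl))
  have hb₁₂ : b₁ ∉ andPair I j₂ := hdj b₁ ((mem_andPair_iff I j₁ b₁).2 (Or.inr rfl))
  rw [mem_andPair_iff] at ha₁₂ hb₁₂
  push Not at ha₁₂ hb₁₂
  have hτ₁ : τ ≠ a₁ ∧ τ ≠ b₁ := by
    rcases hτ' with rfl | rfl
    · exact ⟨fun h => ha₁₂.1 h.symm, fun h => hb₁₂.1 h.symm⟩
    · exact ⟨fun h => ha₁₂.2 h.symm, fun h => hb₁₂.2 h.symm⟩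
  have hσ₂ : σ ≠ a₂ ∧ σ ≠ b₂ := by
    rcases hσ' with rfl | rfl
    · exact ha₁₂
    · exact hb₁₂
  -- the gadget's monomial is `x_σ x_τ`
  have hkpair : ∀ x : Fin n → ZMod 2, x (I.vars k 2) * x (I.vars k 3) = x σ * x τ := by
    intro x
    rw [mem_andPair_iff] at hσk hτk
    have hk23 : I.vars k 2 ≠ I.vars k 3 := and_ne I hI k
    rcases hσk with h2 | h3 <;> rcases hτk with h2' | h3'
    · exact absurd (h2.trans h2'.symm) hστ
    · rw [h2, h3']
    · rw [h3, h2', mul_comm]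
    · exact absurd (h3.trans h3'.symm) hστ
  -- `q = Q_{D e'} + x_σ x_τ + κ`
  have hq : ∀ x : Fin n → ZMod 2, qDir I B (1, 0) x = (x a₁ * x b₁ + x a₂ * x b₂) + x σ * x τ + κ := by
    intro x
    have h := hEQ x
    rw [hDins, qform, sum_insert hk', ← qform, hD, qform_pair_family I hj, hkpair] at h
    have e2 : ∀ p Q q k : ZMod 2, p + Q = q + k → q = Q + p + k := by decide
    exact e2 _ _ _ _ h
  have hQ' : ∀ x : Fin n → ZMod 2, qform (B.D e') (fun j => I.vars j 2) (fun j => I.vars j 3) x = x a₁ * x b₁ + x a₂ * x b₂ := by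
    intro x; rw [hD, qform_pair_family I hj]
  have z01 : κ = 0 ∨ κ = 1 := by generalize κ = t; revert t; decide
  rcases z01 with hκ | hκ
  · -- κ = 0: points `e_σ` (gives `c = 0`) and `e_{a₁} + e_{b₁} + e_τ` (gives `c = 1`)
    have hA : c = 0 := by
      set x : Fin n → ZMod 2 := fun w => if w ∈ ({σ} : Finset (Fin n)) then 1 else 0 with hx
      have h1 : x a₁ * x b₁ = 0 := by
        rw [hx, ind_mul]; rw [if_neg]; simp only [mem_singleton]; rintro ⟨h1, h2⟩; exact hab₁ (h1.trans h2.symm)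
      have h2 : x a₂ * x b₂ = 0 := by
        rw [hx, ind_mul]; rw [if_neg]; simp only [mem_singleton]; rintro ⟨h1, -⟩; exact hσ₂.1 h1.symm
      have h3 : x σ * x τ = 0 := by
        rw [hx, ind_mul]; rw [if_neg]; simp only [mem_singleton]; rintro ⟨-, h2⟩; exact hστ h2.symm
      have hz : qDir I B (1, 0) x = 0 := by rw [hq, h1, h2, h3, hκ]; decide
      have := hP1 x hz
      rw [hQ', h1, h2, add_zero] at this
      exact this.symm
    have hB : c = 1 := by
      set x : Fin n → ZMod 2 := fun w => if w ∈ ({a₁, b₁, τ} : Finset (Fin n)) then 1 else 0 with hx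
      have h1 : x a₁ * x b₁ = 1 := by
        rw [hx, ind_mul, if_pos]; simp
      have h2 : x a₂ * x b₂ = 0 := by
        rw [hx, ind_mul, if_neg]
        simp only [mem_insert, mem_singleton]
        rintro ⟨h1, h2⟩
        rcases h1 with h1 | h1 | h1
        · exact ha₁₂.1 h1.symm
        · exact hb₁₂.1 h1.symm
        · rcases h2 with h2 | h2 | h2
          · exact ha₁₂.2 h2.symm
          · exact hb₁₂.2 h2.symm
          · exact hab₂ (h1.trans h2.symm)
      have h3 : x σ * x τ = 1 := by
        rw [hx, ind_mul, if_pos]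
        simp only [mem_insert, mem_singleton]
        exact ⟨by rcases hσ' with h | h <;> simp [h], by simp⟩
      have hz : qDir I B (1, 0) x = 0 := by rw [hq, h1, h2, h3, hκ]; decide
      have := hP1 x hz
      rw [hQ', h1, h2, add_zero] at this
      exact this.symm
    rw [hA] at hB
    exact zero_ne_one hB
  · -- κ = 1: points `e_{a₁} + e_{b₁}` (gives `c = 1`) and `e_σ + e_τ` (gives `c = 0`)
    have hA : c = 1 := by
      set x : Fin n → ZMod 2 := fun w => if w ∈ ({a₁, b₁} : Finset (Fin n)) then 1 else 0 with hx
      have h1 : x a₁ * x b₁ = 1 := by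
        rw [hx, ind_mul, if_pos]; simp
      have h2 : x a₂ * x b₂ = 0 := by
        rw [hx, ind_mul, if_neg]
        simp only [mem_insert, mem_singleton]
        rintro ⟨h1, -⟩
        rcases h1 with h1 | h1
        · exact ha₁₂.1 h1.symm
        · exact hb₁₂.1 h1.symm
      have h3 : x σ * x τ = 0 := by
        rw [hx, ind_mul, if_neg]
        simp only [mem_insert, mem_singleton]
        rintro ⟨-, h2⟩
        rcases h2 with h2 | h2
        · exact hτ₁.1 h2
        · exact hτ₁.2 h2
      have hz : qDir I B (1, 0) x = 0 := by rw [hq, h1, h2, h3, hκ]; decide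
      have := hP1 x hz
      rw [hQ', h1, h2, add_zero] at this
      exact this.symm
    have hB : c = 0 := by
      set x : Fin n → ZMod 2 := fun w => if w ∈ ({σ, τ} : Finset (Fin n)) then 1 else 0 with hx
      have h1 : x a₁ * x b₁ = 0 := by
        rw [hx, ind_mul, if_neg]
        simp only [mem_insert, mem_singleton]
        rintro ⟨h1, h2⟩
        rcases h1 with h1 | h1
        · rcases h2 with h2 | h2
          · exact hab₁ (h1.trans h2.symm)
          · exact hτ₁.2 h2.symm
        · exact hτ₁.1 h1.symm
      have h2 : x a₂ * x b₂ = 0 := by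
        rw [hx, ind_mul, if_neg]
        simp only [mem_insert, mem_singleton]
        rintro ⟨h1, h2⟩
        rcases h1 with h1 | h1
        · exact hσ₂.1 h1.symm
        · rcases h2 with h2 | h2
          · exact hσ₂.2 h2.symm
          · exact hab₂ (h1.trans h2.symm)
      have h3 : x σ * x τ = 1 := by
        rw [hx, ind_mul, if_pos]; simp
      have hz : qDir I B (1, 0) x = 0 := by rw [hq, h1, h2, h3, hκ]; decide
      have := hP1 x hz
      rw [hQ', h1, h2, add_zero] at this
      exact this.symm
    rw [hB] at hA
    exact zero_ne_one hA

end Summit.PneNP.PneNP.Theorems.PstarGateCasePUnitsMixed
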